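import Literature.MathematicalPhysics.QuantumManyBody.BosonicFloor
import HarnessLib

/-!
# Crux `CorrectorClosure` (stmt-AtomisticToContinuum-12058), line `llp-fidelity-arc` —
registered stub `stub_bosonicFloor`

Supports (does not close) stmt-AtomisticToContinuum-12058, route `BECInsertionCorrector`.
The registered stub "bosonic ground-state energy ≤ bath-symmetric (tagged, `κ = 1`) ground-state
energy" of the lead's skeleton, i.e. `periodicGroundStateEnergy v (N+1) L ≤
taggedPeriodicGroundStateEnergy v 1 N L`, specialised from the Literature theorem
`periodicGroundStateEnergy_succ_le_taggedPeriodicGroundStateEnergy_one` (`BosonicFloor.lean`: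
symmetrisation of the density over the `(N+1)!` relabellings, the `C¹` regularisation
`√(ε² + F) − ε` with the pointwise convexity inequality for gradients, and removal of `ε` by
dominated convergence — no Perron–Frobenius). Only the measurability of `v` in
`IsRepulsiveFiniteRange v` is used; `0 < L` is not needed.
-/

noncomputable section

open scoped ENNReal NNReal

namespace Summit.AtomisticToContinuum.BoseEinsteinCondensation.Theorems.CorrectorClosure.LlpFidelityArc

open Literature.MathematicalPhysics.QuantumManyBody.BoseGas

/-- **Registered stub of line `llp-fidelity-arc` — the bosonic floor.** For a repulsive
finite-range pair potential `v`, `N` bath particles and a torus of side `L > 0`, the Bose-symmetric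
periodic ground-state energy of `N + 1` particles is at most the ground-state energy over tagged
states (particle `0` distinguishable, bath Bose-symmetric) at equal masses:
`E^per(N+1, L) ≤ E^tagged_{κ=1}(N, L)` (hence `=`, by `taggedPeriodicGroundStateEnergy_one_le`);
the bosonic ground-state energy is the absolute one (LSSY2005, Ch. 2). [folklore] -/
theorem stub_bosonicFloor :
    ∀ (v : ℝ → ℝ≥0∞), IsRepulsiveFiniteRange v → ∀ (N : ℕ) (L : ℝ), 0 < L →
      periodicGroundStateEnergy v (N + 1) L ≤ taggedPeriodicGroundStateEnergy v 1 N L :=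
  fun _ hv N L _ => periodicGroundStateEnergy_succ_le_taggedPeriodicGroundStateEnergy_one hv.1 N L

end Summit.AtomisticToContinuum.BoseEinsteinCondensation.Theorems.CorrectorClosure.LlpFidelityArc

end
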